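import Literature.MathematicalPhysics.QuantumFieldTheory.Balaban1983to89.B9Eq3119DeltaPiTower
import Literature.MathematicalPhysics.QuantumFieldTheory.Balaban1983to89.B9Eq3124GaugeModes

/-!
# `Balaban1983to89.B9Eq3130HessianSlotDifferenceTower` — T. Bałaban, *Propagators for lattice gauge theories in a background field*, Commun. Math. Phys.
# **99** (1985) 389–434 [Balaban1985BackgroundPropagators] (3.130) p. 421 (*«G = G₀(I − Δ′_πG₀)⁻¹ = Σ_{n=0}^{∞} G₀(Δ′_πG₀)ⁿ»*), (3.119)–(3.120) p. 419, (3.122) p. 420,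
# (3.26) p. 395: **THE OPERATOR FORM OF THE HESSIAN-SLOT PERTURBATION AT THE `k`-TH STEP — `π_k† = 1 − D_UR_kG′_kD*_U`, `Δ̃_{a,k} − Δ_{a,k} = π_k†Δ^η(U)π_k − Δ^η(U)
# = −M∘P − P†∘M†∘π_k` (`M = Δ^η(U)∘D_U`, `M† = D*_U∘Δ^η(U)`, `P = G′_kR_kD*_U`, `P† = D_UR_kG′_k`), AND THE RESOLVENT IDENTITY `G̃ = G₀ + G₀MPG̃ + G₀P†M†π_kG̃`** —
# the tower instance of the hypothesis (hT) of the `G₀ ↦ G̃` pair transfer (the NE9 owner's plan v14, journal `HOME/CLAIMS.log` l.65765–65766, in ne9-leaf-05 g88's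
# form C-leaf05-g88-1 (iii) l.65943; ne9-leaf-03 g80 W-1∕A-1∕INTENT-2 l.65985∕65994∕66033)

statement-level skeleton of published theorems with citation tags; proofs where landed; nothing here is a claim about the Yang–Mills mass gap

CITATION HEADER (lean-in-tree rule).  Audit cell `pub-balaban`, sub-cell `t4`, BINDER row NE9; filed by NE9 crux-team LEAF PROVER 03
(`b2b-balaban-t4-ne9-formalise-leaf-03`, gen 80; road ΔA-CT).  Composed BY NAME, nothing restated: the owner's `B9Eq3119DeltaPiTower` (`piOfUk = 1 − D_U∘G′∘R_k∘D*_U`,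
`laplaceAkPi` = (3.122) with the `Δ₁`-slot `π_k† ∘ Δ^η(U) ∘ π_k`), `B9Eq326OperatorTower` (`laplaceAk`, `G1k`, `RofUk_isSymmetric`), `B9Eq324DeltaPrimeATower`
(`GpOfUk`, `laplacePrimeAk_isSymmetric`), ne9-leaf-01's `B9Eq3124GaugeModes.greenK_isSymmetric`, `B11Eq103H1Complex` (`laplaceALatticeK`∕`laplaceAK_apply`,
`adjoint_covDerivL2K` = «`D* = D†`», `laplaceALatticeK_G1LatticeK`, `greenK_apply`), Mathlib's `LinearMap.adjoint_comp`∕`adjoint_adjoint`∕`adjoint_id`∕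
`IsSymmetric.adjoint_eq`.  Source READ first-hand this generation (`paper:balaban1985-cmp99-background-propagators`, journal page = PDF page + 388): p. 419
(3.117)–(3.120), p. 420 (3.122), p. 421 (3.130), p. 422 l.1–9.

THE PRINT (verbatim).  p. 421: *«Let us denote for a moment the operator we have investigated in previous sections by G₀, i.e. G₀ = (Δ + DRD* + Q*aQ)⁻¹. From (3.120)
we get G = G₀(I − Δ′_πG₀)⁻¹ = Σ_{n=0}^{∞} G₀(Δ′_πG₀)ⁿ. (3.130)»*; p. 419: *«(A, Δ_πA) = ⟨A − DG′RD*A, Δ(A − DG′RD*A)⟩. (3.119)»*, i.e. `Δ_π = π†Δπ` with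
`π = 1 − DG′RD*`, and `Δ′_π := Δ_π − Δ` ((3.120)).  Expanding with `E := DG′RD*`, `π = 1 − E`, `E† = DRG′D*`: `Δ′_π = −E†Δπ − ΔE = −(DRG′)(D*Δ)π − (ΔD)(G′RD*)` — both
terms factor through the Hessian ON or AGAINST a pure gauge mode, `M = Δ∘D` resp. `M† = D*∘Δ`, which (3.117) (p. 419) evaluates as the commutator with the current
`J = D*η⁻²Im ∂U` (ne9-leaf-05 g88 C-1 (i); r06's `B9Eq3117Polarized`); this file records the factorisation, not the evaluation.

WHY THIS FILE (cell context).  The one-sided (L)-letter «(L)(Δ′_π,k; B′ small)» is NOT inhabitable (ne9-leaf-03 g79 W-3 l.65752, agreed by the owner A-3 l.65765):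
every term of `Δ′_π` differentiates the raw input.  The transfer of the landed sup letters of `G₀ = G1k` to print's `G̃_k = Δ̃_{a,k}⁻¹` therefore runs as a
bootstrap on the PAIR (value row of `G̃_k`, divergence row `D*_UG̃_k`) in ne9-leaf-05's (K71)∕(K72) frame, whose hypothesis (hT) is the resolvent identity with
`Δ′_π` FACTORED as above: the unknown `G̃` is only ever hit by `P = G′_kR_kD*_U` (its divergence row) or by `M†π_k` (a zero-order stencil under print's (3.36)),
and the known `G₀` only by its range rows and by `G₀P† = G₀D_UR_kG′_k` (`B9Eq3152BareHessianGaugeModeTower`, this lineage).  THIS FILE is (hT) at the tower.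

WHAT IS PROVED (sorry-free; proof lane — no `def`, no `Prop` placeholder; [folklore] linear algebra BY NAME).
* §1 **`adjoint_piOfUk`** — for mutually adjoint transporters (`hRS`) and a SYMMETRIC letter `Gp`: `π_k† = 1 − D_U ∘ R_k ∘ Gp ∘ D*_U`;
  **`GpOfUk_isSymmetric`** — print's `G′_k = GpOfUk` is symmetric (so `adjoint_piOfUk` applies to it: **`adjoint_piOfUk_GpOfUk`**).
* §2 **`laplaceAkPi_sub_laplaceAk`** — `Δ̃_{a,k} − Δ_{a,k} = π_k†∘Δ^η(U)∘π_k − Δ^η(U)` (`laplaceALatticeK` is affine in its Hessian slot);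
  **`adjointPi_hessOp_pi_sub_hessOp`** — `π_k†Hπ_k − H = −(H∘D_U)∘(G′_k∘R_k∘D*_U) − (D_U∘R_k∘G′_k)∘(D*_U∘H)∘π_k`;
  **`laplaceAkPi_eq_laplaceAk_sub_stencils`** — `Δ̃_{a,k} = Δ_{a,k} − M∘P − P†∘M†∘π_k` with `M, M†, P, P†` as displayed compositions.
* §3 **`laplaceAk_G1LatticeKPi`** — `Δ_{a,k}(G̃f) = f + M(P(G̃f)) + P†(M†(π_k(G̃f)))` (the dressing operator `𝔅_k = Δ_{a,k}∘G̃_k` evaluated);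
  **`G1LatticeKPi_eq_G1k_laplaceAk`** — (d′) `G̃f = G₀(Δ_{a,k}(G̃f))` (right grouping `G̃_k = G1k∘𝔅_k`, t4-ne9-idea-1 N55 ∕ owner R-ne9p1-g97-2);
  **`laplaceAk_G1LatticeKPi_eq_dressing`** — (d″) `𝔅_k = 1 − K_k∘𝔅_k` pointwise, `K_k = Δ′_π,k∘G₀`;
  **`G1kPi_resolvent_stencils`** — with `G̃ := G1LatticeK hposπ` (at `Δ̃_{a,k}`) and `G₀ := G1k … hpos`: for every `f`,
  `G̃f = G₀f + G₀(M(P(G̃f))) + G₀(P†(M†(π_k(G̃f))))` — (K72)'s (hT) up to `toContinuousLinearMap` coercions (pointwise form; the operator-level equality is not stated — its elaboration exceeds `maxRecDepth`).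
HONEST SCOPE.  Pure algebra of the cell's own constructed objects; no estimate, no window, no constant; displayed exactly as in `B9Eq3119DeltaPiTower`: the
positivity witnesses `hpos` (`Δ_{a,k}`), `hposπ` (`Δ̃_{a,k}`), `hpos′` (`Δ′_{a′,k}`) ([B9] Thm 3.11) and the adjointness of the transporters `hRS` (unitary class,
`adTransportW_adjoint`); nothing of [B9] (3.117)∕(3.120)∕(3.130)–(3.131)∕Thm 3.3∕3.12 is asserted, valued or discharged; «NE9 ⇐ the named binders»; NE9 NOT PRINTED ∕
NOT PROVED; row WALLED ON A MODEL (O-NE9-1; #5 UNRULED); spine PROVED 0∕9; rung (B)+1 on a finite T⁴ — NOT infinite volume, NOT mass gap, NOT BetaPertH, NOT Clay.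
HONEST DEPENDENCY: continuum YM on T⁴ ⇐ BetaPertH ∧ nine spine estimates (0/9 proved); BetaPertH ⇐ (D1) ∧ (D4) ∧ CAP+tail; G-an2-4 gates asym, D1 and NE2/3/4.
NEW file importing two BUILT modules; nothing modified.  Net new unproved facts: 0.
-/

noncomputable section

set_option autoImplicit false

open scoped InnerProductSpace ComplexConjugate BigOperators

namespace Literature.MathematicalPhysics.QuantumFieldTheory.Balaban1983to89.B9Eq3130HessianSlotDifferenceTower

open B11Eq103H1Complex
open B4Sect5Torus (TSite)
open B9SectCLatticeCarrier (Bond)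
open B7Prop1Explicit (U1 Wcx boxVec)
open B9Eq310HessianOperator (adTransportW hessOp)
open B9Eq315QTorus (perCfg cornerSite)
open B9Eq315QTower (towerP UlevOf)
open B9Eq326OperatorTower (QprimeTowerW QkW RofUk RofUk_isSymmetric laplaceAk G1k)
open B9Eq324DeltaPrimeATower (laplacePrimeAk GpOfUk laplacePrimeAk_isSymmetric)
open B9Eq3124GaugeModes (greenK_isSymmetric)
open B9Eq3119DeltaPiTower (piOfUk laplaceAkPi)

variable {d : ℕ} (L : ℕ) [NeZero L] (m : Fin d → ℕ) [∀ i, NeZero (m i)] (n : ℕ)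
  {𝔸 : Type*} [NormedRing 𝔸] [NormedAlgebra ℂ 𝔸] [CompleteSpace 𝔸] [StarRing 𝔸] [StarModule ℂ 𝔸] [NormOneClass 𝔸]
  {W : Type*} [NormedAddCommGroup W] [InnerProductSpace ℂ W] [FiniteDimensional ℂ W] (φ : W ≃ₗ[ℂ] 𝔸) {c₀ c₁ : ℝ} [Fact (0 < c₀)] [Fact (0 < c₁)]
  (τ : 𝔸 →ₗ[ℂ] ℂ) (η : ℝ) (U : Bond d (towerP L m (n + 1)) → 𝔸ˣ)
  (hRS : ∀ (b : Bond d (towerP L m (n + 1))) (v u : W), ⟪adTransportW φ U b v, u⟫_ℂ = ⟪v, adTransportW φ (fun b => (U b)⁻¹) b u⟫_ℂ)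

/-! ## §1 The adjoint of print's `π_k(U)` -/

omit [StarRing 𝔸] [StarModule ℂ 𝔸] [NormOneClass 𝔸] [Fact (0 < c₁)] in
include hRS in
/-- **`π_k† = 1 − D_U ∘ R_k ∘ G′ ∘ D*_U`** for mutually adjoint transporters and a SYMMETRIC Green's-function letter `Gp` (`D*_U = D_U†`, `R_k† = R_k`, `G′† = G′`).
[folklore] [cite: Balaban1985BackgroundPropagators, (3.119) p.419, (3.21) p.394, (3.8) p.392] -/
theorem adjoint_piOfUk (Gp : SiteL2K ℂ d (towerP L m (n + 1)) c₀ W →ₗ[ℂ] SiteL2K ℂ d (towerP L m (n + 1)) c₀ W) (hGp : Gp.IsSymmetric) :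
    LinearMap.adjoint (piOfUk L m n φ η U Gp) =
      LinearMap.id - covDerivL2K ℂ c₀ ((η : ℂ))⁻¹ (adTransportW φ U) ∘ₗ RofUk L m n φ η U ∘ₗ Gp ∘ₗ
        covDivL2K ℂ c₀ ((η : ℂ))⁻¹ (adTransportW φ fun b => (U b)⁻¹) := by
  have hc : conj (((η : ℂ))⁻¹) = ((η : ℂ))⁻¹ := by rw [map_inv₀, Complex.conj_ofReal]
  have hD : LinearMap.adjoint (covDerivL2K ℂ c₀ ((η : ℂ))⁻¹ (adTransportW φ U)) =
      covDivL2K ℂ c₀ ((η : ℂ))⁻¹ (adTransportW φ fun b => (U b)⁻¹) := adjoint_covDerivL2K _ hc _ _ hRS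
  have hDs : LinearMap.adjoint (covDivL2K ℂ c₀ ((η : ℂ))⁻¹ (adTransportW φ fun b => (U b)⁻¹)) =
      covDerivL2K ℂ c₀ ((η : ℂ))⁻¹ (adTransportW φ U) := by rw [← hD, LinearMap.adjoint_adjoint]
  unfold piOfUk
  rw [map_sub, LinearMap.adjoint_id, LinearMap.adjoint_comp, LinearMap.adjoint_comp, LinearMap.adjoint_comp, hD, hDs,
    (RofUk_isSymmetric L m n φ η U).adjoint_eq, hGp.adjoint_eq]
  simp only [LinearMap.comp_assoc]

variable (a' : ℝ)
  (hpos' : ∀ x : SiteL2K ℂ d (towerP L m (n + 1)) c₀ W, x ≠ 0 → 0 < RCLike.re ⟪x, laplacePrimeAk L m n φ η U a' (c₁ := c₁) x⟫_ℂ)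

omit [StarRing 𝔸] [StarModule ℂ 𝔸] [NormOneClass 𝔸] in
include hRS in
/-- **Print's `G′_k = (Δ′_{a′,k})⁻¹` IS SYMMETRIC** (the inverse of the symmetric positive `Δ′_{a′,k}`: `laplacePrimeAk_isSymmetric` + `greenK_isSymmetric`). [folklore]
[cite: Balaban1985BackgroundPropagators, (3.24)–(3.25) p.394, Thm 3.11 p.416] -/
theorem GpOfUk_isSymmetric : (GpOfUk L m n φ η U a' hpos').IsSymmetric := by
  unfold GpOfUk
  exact greenK_isSymmetric hpos' (laplacePrimeAk_isSymmetric L m n φ η U a' hRS)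

omit [StarRing 𝔸] [StarModule ℂ 𝔸] [NormOneClass 𝔸] in
include hRS in
/-- `adjoint_piOfUk` at print's `G′_k`: **`π_k(U)† = 1 − D_U ∘ R_k(U) ∘ G′_k ∘ D*_U`**. [folklore] [cite: Balaban1985BackgroundPropagators, (3.119) p.419] -/
theorem adjoint_piOfUk_GpOfUk :
    LinearMap.adjoint (piOfUk L m n φ η U (GpOfUk L m n φ η U a' hpos')) =
      LinearMap.id - covDerivL2K ℂ c₀ ((η : ℂ))⁻¹ (adTransportW φ U) ∘ₗ RofUk L m n φ η U ∘ₗ GpOfUk L m n φ η U a' hpos' ∘ₗ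
        covDivL2K ℂ c₀ ((η : ℂ))⁻¹ (adTransportW φ fun b => (U b)⁻¹) :=
  adjoint_piOfUk L m n φ η U hRS _ (GpOfUk_isSymmetric L m n φ η U hRS a' hpos')

/-! ## §2 `Δ̃_{a,k} − Δ_{a,k}` factored through the gauge-mode stencils -/

variable (hL : 1 ≤ L) (αU : ℕ → ℝ) (hα1 : ∀ j, αU j ≤ 1 / 64)
  (hU1 : ∀ (j : ℕ) (x : B7Prop1Explicit.Site d) (κ : Fin d), perCfg (towerP L m (j + 1)) (UlevOf L m (n + 1) U j) x κ ∈ U1 𝔸)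
  (hreg : ∀ (j : ℕ) (y : TSite d (towerP L m j)) (κ : Fin d) (r : Fin d → Fin L),
    ‖((Wcx L (perCfg (towerP L m (j + 1)) (UlevOf L m (n + 1) U j)) (cornerSite L y) κ (boxVec L r) : 𝔸ˣ) : 𝔸) - 1‖ ≤ αU j)
  (a : ℝ)

/-- **`Δ̃_{a,k} − Δ_{a,k} = π_k†∘Δ^η(U)∘π_k − Δ^η(U)`** — print's `Δ′_π` of (3.120) at the `k`-th step: the two operators (3.122) and (3.26) share the slots
`D_UR_kD*_U` and `Q_k†(a•Q_k)` and differ in the Hessian slot only. [folklore] [cite: Balaban1985BackgroundPropagators, (3.120) p.419, (3.122) p.420, (3.26) p.395] -/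
theorem laplaceAkPi_sub_laplaceAk :
    laplaceAkPi L m n φ τ η U a' hpos' hL αU hα1 hU1 hreg (c₁ := c₁) a - laplaceAk L m n φ η U hL αU hα1 hU1 hreg τ (c₀ := c₀) (c₁ := c₁) a =
      LinearMap.adjoint (piOfUk L m n φ η U (GpOfUk L m n φ η U a' hpos')) ∘ₗ hessOp φ η U τ ∘ₗ piOfUk L m n φ η U (GpOfUk L m n φ η U a' hpos') -
        hessOp φ η U τ := by
  apply LinearMap.ext
  intro x
  simp only [laplaceAkPi, laplaceAk, laplaceALatticeK, LinearMap.sub_apply, laplaceAK_apply]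
  abel

omit [NormOneClass 𝔸] in
include hRS in
/-- **`π_k†Hπ_k − H = −(H∘D_U)∘(G′_k∘R_k∘D*_U) − (D_U∘R_k∘G′_k)∘(D*_U∘H)∘π_k`** (`H = Δ^η(U)`): with `E = D_UG′_kR_kD*_U`, `π_k = 1 − E`, `π_k† = 1 − E†`,
`π_k†Hπ_k − H = (Hπ_k − H) − E†Hπ_k = −HE − E†Hπ_k`. [folklore] [cite: Balaban1985BackgroundPropagators, (3.119)–(3.120) p.419, (3.117) p.419] -/
theorem adjointPi_hessOp_pi_sub_hessOp :
    LinearMap.adjoint (piOfUk L m n φ η U (GpOfUk L m n φ η U a' hpos')) ∘ₗ hessOp φ η U τ ∘ₗ piOfUk L m n φ η U (GpOfUk L m n φ η U a' hpos') -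
        hessOp φ η U τ =
      -((hessOp φ η U τ ∘ₗ covDerivL2K ℂ c₀ ((η : ℂ))⁻¹ (adTransportW φ U)) ∘ₗ
          (GpOfUk L m n φ η U a' hpos' ∘ₗ RofUk L m n φ η U ∘ₗ covDivL2K ℂ c₀ ((η : ℂ))⁻¹ (adTransportW φ fun b => (U b)⁻¹))) -
        (covDerivL2K ℂ c₀ ((η : ℂ))⁻¹ (adTransportW φ U) ∘ₗ RofUk L m n φ η U ∘ₗ GpOfUk L m n φ η U a' hpos') ∘ₗ
          (covDivL2K ℂ c₀ ((η : ℂ))⁻¹ (adTransportW φ fun b => (U b)⁻¹) ∘ₗ hessOp φ η U τ) ∘ₗ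
            piOfUk L m n φ η U (GpOfUk L m n φ η U a' hpos') := by
  rw [adjoint_piOfUk_GpOfUk L m n φ η U hRS a' hpos']
  apply LinearMap.ext
  intro x
  simp only [piOfUk, LinearMap.sub_apply, LinearMap.comp_apply, LinearMap.id_apply, LinearMap.neg_apply, map_sub]
  abel

include hRS in
/-- **`Δ̃_{a,k} = Δ_{a,k} − M∘P − P†∘M†∘π_k`** with the STENCILS `M := Δ^η(U)∘D_U` (sites → bonds), `M† := D*_U∘Δ^η(U)` (bonds → sites) and `P := G′_kR_kD*_U`,
`P† := D_UR_kG′_k` — the form in which the `G₀ ↦ G̃` transfer consumes (3.130) (ne9-leaf-05 g88 C-1 (iii)). [folklore]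
[cite: Balaban1985BackgroundPropagators, (3.130) p.421, (3.120) p.419, (3.122) p.420] -/
theorem laplaceAkPi_eq_laplaceAk_sub_stencils :
    laplaceAkPi L m n φ τ η U a' hpos' hL αU hα1 hU1 hreg (c₁ := c₁) a =
      laplaceAk L m n φ η U hL αU hα1 hU1 hreg τ (c₀ := c₀) (c₁ := c₁) a -
        (hessOp φ η U τ ∘ₗ covDerivL2K ℂ c₀ ((η : ℂ))⁻¹ (adTransportW φ U)) ∘ₗ
          (GpOfUk L m n φ η U a' hpos' ∘ₗ RofUk L m n φ η U ∘ₗ covDivL2K ℂ c₀ ((η : ℂ))⁻¹ (adTransportW φ fun b => (U b)⁻¹)) -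
        (covDerivL2K ℂ c₀ ((η : ℂ))⁻¹ (adTransportW φ U) ∘ₗ RofUk L m n φ η U ∘ₗ GpOfUk L m n φ η U a' hpos') ∘ₗ
          (covDivL2K ℂ c₀ ((η : ℂ))⁻¹ (adTransportW φ fun b => (U b)⁻¹) ∘ₗ hessOp φ η U τ) ∘ₗ
            piOfUk L m n φ η U (GpOfUk L m n φ η U a' hpos') := by
  have h := laplaceAkPi_sub_laplaceAk L m n φ τ η U a' hpos' hL αU hα1 hU1 hreg a
  rw [adjointPi_hessOp_pi_sub_hessOp L m n φ τ η U hRS a' hpos'] at h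
  rw [← sub_add_cancel (laplaceAkPi L m n φ τ η U a' hpos' hL αU hα1 hU1 hreg (c₁ := c₁) a)
    (laplaceAk L m n φ η U hL αU hα1 hU1 hreg τ (c₀ := c₀) (c₁ := c₁) a), h]
  abel

/-! ## §3 The resolvent identity (hT) of the pair transfer -/

variable
  (hpos : ∀ x : BondL2K ℂ d (towerP L m (n + 1)) c₀ W, x ≠ 0 →
    0 < RCLike.re ⟪x, laplaceAk L m n φ η U hL αU hα1 hU1 hreg τ (c₀ := c₀) (c₁ := c₁) a x⟫_ℂ)
  (hposπ : ∀ x : BondL2K ℂ d (towerP L m (n + 1)) c₀ W, x ≠ 0 →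
    0 < RCLike.re ⟪x, laplaceAkPi L m n φ τ η U a' hpos' hL αU hα1 hU1 hreg (c₁ := c₁) a x⟫_ℂ)

/-- `G₁(U)(Δ_{a,k}(U)f) = f` (finite dimension: the constructed right inverse is a left inverse, `greenK_apply`). [folklore]
[cite: Balaban1985BackgroundPropagators, Thm 3.11 p.416; Balaban1985Variational, (110) p.294] -/
private theorem G1k_laplaceAk_apply (f : BondL2K ℂ d (towerP L m (n + 1)) c₀ W) :
    G1k L m n φ η U hL αU hα1 hU1 hreg τ (c₀ := c₀) (c₁ := c₁) hpos (laplaceAk L m n φ η U hL αU hα1 hU1 hreg τ (c₀ := c₀) (c₁ := c₁) a f) = f := by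
  unfold G1k B11Eq103H1Complex.G1LatticeK B11Eq103H1Complex.G1K laplaceAk B11Eq103H1Complex.laplaceALatticeK
  rw [greenK_apply]

/-- `Δ̃_{a,k}(U)(G̃f) = f` for `G̃ := G1LatticeK hposπ` (`laplaceALatticeK_G1LatticeK` at (3.122)'s slots). [folklore]
[cite: Balaban1985BackgroundPropagators, (3.122) p.420, Thm 3.11 p.416] -/
private theorem laplaceAkPi_G1LatticeK_apply (f : BondL2K ℂ d (towerP L m (n + 1)) c₀ W) :
    laplaceAkPi L m n φ τ η U a' hpos' hL αU hα1 hU1 hreg (c₁ := c₁) a (G1LatticeK hposπ f) = f := by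
  unfold laplaceAkPi
  exact laplaceALatticeK_G1LatticeK hposπ f

include hRS in
/-- **`Δ_{a,k}(G̃f) = f + M(P(G̃f)) + P†(M†(π_k(G̃f)))`** — `laplaceAkPi_eq_laplaceAk_sub_stencils` applied to `G̃f` with `Δ̃_{a,k}(G̃f) = f`: the DRESSING
OPERATOR `𝔅_k := Δ_{a,k}∘G̃_k` of the right-grouped form of (3.130) (`G̃ = G₀(I − Δ′_πG₀)⁻¹`, t4-ne9-idea-1 N55) evaluated. [folklore]
[cite: Balaban1985BackgroundPropagators, (3.130) p.421, (3.120) p.419] -/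
theorem laplaceAk_G1LatticeKPi (f : BondL2K ℂ d (towerP L m (n + 1)) c₀ W) :
    laplaceAk L m n φ η U hL αU hα1 hU1 hreg τ (c₀ := c₀) (c₁ := c₁) a (G1LatticeK hposπ f) =
      f + hessOp φ η U τ (covDerivL2K ℂ c₀ ((η : ℂ))⁻¹ (adTransportW φ U)
            (GpOfUk L m n φ η U a' hpos' (RofUk L m n φ η U (covDivL2K ℂ c₀ ((η : ℂ))⁻¹ (adTransportW φ fun b => (U b)⁻¹)
              (G1LatticeK hposπ f))))) +
        covDerivL2K ℂ c₀ ((η : ℂ))⁻¹ (adTransportW φ U) (RofUk L m n φ η U (GpOfUk L m n φ η U a' hpos'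
            (covDivL2K ℂ c₀ ((η : ℂ))⁻¹ (adTransportW φ fun b => (U b)⁻¹) (hessOp φ η U τ
              (piOfUk L m n φ η U (GpOfUk L m n φ η U a' hpos') (G1LatticeK hposπ f)))))) := by
  -- `Δ_{a,k} = Δ̃_{a,k} + M∘P + P†∘M†∘π` as operators
  have hop : laplaceAk L m n φ η U hL αU hα1 hU1 hreg τ (c₀ := c₀) (c₁ := c₁) a =
      laplaceAkPi L m n φ τ η U a' hpos' hL αU hα1 hU1 hreg (c₁ := c₁) a +
        (hessOp φ η U τ ∘ₗ covDerivL2K ℂ c₀ ((η : ℂ))⁻¹ (adTransportW φ U)) ∘ₗ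
          (GpOfUk L m n φ η U a' hpos' ∘ₗ RofUk L m n φ η U ∘ₗ covDivL2K ℂ c₀ ((η : ℂ))⁻¹ (adTransportW φ fun b => (U b)⁻¹)) +
        (covDerivL2K ℂ c₀ ((η : ℂ))⁻¹ (adTransportW φ U) ∘ₗ RofUk L m n φ η U ∘ₗ GpOfUk L m n φ η U a' hpos') ∘ₗ
          (covDivL2K ℂ c₀ ((η : ℂ))⁻¹ (adTransportW φ fun b => (U b)⁻¹) ∘ₗ hessOp φ η U τ) ∘ₗ
            piOfUk L m n φ η U (GpOfUk L m n φ η U a' hpos') := by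
    rw [laplaceAkPi_eq_laplaceAk_sub_stencils L m n φ τ η U hRS a' hpos' hL αU hα1 hU1 hreg a]
    abel
  have h1 := LinearMap.congr_fun hop (G1LatticeK hposπ f)
  simp only [LinearMap.add_apply, LinearMap.comp_apply] at h1
  rw [laplaceAkPi_G1LatticeK_apply L m n φ τ η U a' hpos' hL αU hα1 hU1 hreg a hposπ f] at h1
  exact h1

/-- **(d′) `G̃f = G₀(Δ_{a,k}(G̃f))`** — `G̃_k = G1k∘𝔅_k` with the dressing operator `𝔅_k = Δ_{a,k}∘G̃_k` (the right grouping of (3.130): every landed row of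
`G₀ = G1k` post-composes with `𝔅_k`). [folklore] [cite: Balaban1985BackgroundPropagators, (3.130) p.421] -/
theorem G1LatticeKPi_eq_G1k_laplaceAk (f : BondL2K ℂ d (towerP L m (n + 1)) c₀ W) :
    G1LatticeK hposπ f =
      G1k L m n φ η U hL αU hα1 hU1 hreg τ (c₀ := c₀) (c₁ := c₁) hpos
        (laplaceAk L m n φ η U hL αU hα1 hU1 hreg τ (c₀ := c₀) (c₁ := c₁) a (G1LatticeK hposπ f)) :=
  (G1k_laplaceAk_apply L m n φ τ η U hL αU hα1 hU1 hreg a hpos (G1LatticeK hposπ f)).symm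

include hRS in
/-- **(d″) THE DRESSING EQUATION `𝔅_k = 1 − K_k∘𝔅_k`, `K_k := Δ′_π,k∘G₀ = −M∘P∘G₀ − P†∘M†∘π_k∘G₀`, pointwise**: with `u := Δ_{a,k}(G̃f)`,
`u = f + M(P(G₀u)) + P†(M†(π_k(G₀u)))` — the input-side `D*_U` of `P` lands on `G₀u`, whose divergence row is a LANDED letter, so `K_k` has a one-sided letter and
(K71) `letter_of_neumann'` applies with `(G₀, D, T) := (1, −K_k, 𝔅_k)` (the NE9 owner's ruling R-ne9p1-g97-2 (3), t4-ne9-idea-1 N55). [folklore]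
[cite: Balaban1985BackgroundPropagators, (3.130) p.421, (3.120) p.419] -/
theorem laplaceAk_G1LatticeKPi_eq_dressing (f : BondL2K ℂ d (towerP L m (n + 1)) c₀ W) :
    laplaceAk L m n φ η U hL αU hα1 hU1 hreg τ (c₀ := c₀) (c₁ := c₁) a (G1LatticeK hposπ f) =
      f + hessOp φ η U τ (covDerivL2K ℂ c₀ ((η : ℂ))⁻¹ (adTransportW φ U)
            (GpOfUk L m n φ η U a' hpos' (RofUk L m n φ η U (covDivL2K ℂ c₀ ((η : ℂ))⁻¹ (adTransportW φ fun b => (U b)⁻¹)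
              (G1k L m n φ η U hL αU hα1 hU1 hreg τ (c₀ := c₀) (c₁ := c₁) hpos
                (laplaceAk L m n φ η U hL αU hα1 hU1 hreg τ (c₀ := c₀) (c₁ := c₁) a (G1LatticeK hposπ f))))))) +
        covDerivL2K ℂ c₀ ((η : ℂ))⁻¹ (adTransportW φ U) (RofUk L m n φ η U (GpOfUk L m n φ η U a' hpos'
            (covDivL2K ℂ c₀ ((η : ℂ))⁻¹ (adTransportW φ fun b => (U b)⁻¹) (hessOp φ η U τ
              (piOfUk L m n φ η U (GpOfUk L m n φ η U a' hpos')
                (G1k L m n φ η U hL αU hα1 hU1 hreg τ (c₀ := c₀) (c₁ := c₁) hpos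
                  (laplaceAk L m n φ η U hL αU hα1 hU1 hreg τ (c₀ := c₀) (c₁ := c₁) a (G1LatticeK hposπ f)))))))) := by
  rw [G1k_laplaceAk_apply]
  exact laplaceAk_G1LatticeKPi L m n φ τ η U hRS a' hpos' hL αU hα1 hU1 hreg a hposπ f

include hRS in
/-- **(hT) THE RESOLVENT IDENTITY OF (3.130) WITH `Δ′_π` FACTORED THROUGH THE STENCILS**: for `G̃ := Δ̃_{a,k}⁻¹` (`G1LatticeK hposπ`) and `G₀ := G1k`,
`G̃f = G₀f + G₀(M(P(G̃f))) + G₀(P†(M†(π_k(G̃f))))` for every `f`, where `M = Δ^η(U)∘D_U`, `M† = D*_U∘Δ^η(U)`, `P = G′_k∘R_k∘D*_U`, `P† = D_U∘R_k∘G′_k`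
(everything written out applied) — apply `G₀` to `laplaceAkPi_eq_laplaceAk_sub_stencils` at `G̃f`.  No series is formed (print sums (3.130); the cell bootstraps, (K71)).
[folklore] [cite: Balaban1985BackgroundPropagators, (3.130) p.421, (3.120) p.419] -/
theorem G1kPi_resolvent_stencils (f : BondL2K ℂ d (towerP L m (n + 1)) c₀ W) :
    G1LatticeK hposπ f =
      G1k L m n φ η U hL αU hα1 hU1 hreg τ (c₀ := c₀) (c₁ := c₁) hpos f +
        G1k L m n φ η U hL αU hα1 hU1 hreg τ (c₀ := c₀) (c₁ := c₁) hpos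
          (hessOp φ η U τ (covDerivL2K ℂ c₀ ((η : ℂ))⁻¹ (adTransportW φ U)
            (GpOfUk L m n φ η U a' hpos' (RofUk L m n φ η U (covDivL2K ℂ c₀ ((η : ℂ))⁻¹ (adTransportW φ fun b => (U b)⁻¹)
              (G1LatticeK hposπ f)))))) +
        G1k L m n φ η U hL αU hα1 hU1 hreg τ (c₀ := c₀) (c₁ := c₁) hpos
          (covDerivL2K ℂ c₀ ((η : ℂ))⁻¹ (adTransportW φ U) (RofUk L m n φ η U (GpOfUk L m n φ η U a' hpos'
            (covDivL2K ℂ c₀ ((η : ℂ))⁻¹ (adTransportW φ fun b => (U b)⁻¹) (hessOp φ η U τ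
              (piOfUk L m n φ η U (GpOfUk L m n φ η U a' hpos') (G1LatticeK hposπ f))))))) := by
  have h1 := laplaceAk_G1LatticeKPi L m n φ τ η U hRS a' hpos' hL αU hα1 hU1 hreg a hposπ f
  have h2 := congrArg (G1k L m n φ η U hL αU hα1 hU1 hreg τ (c₀ := c₀) (c₁ := c₁) hpos) h1
  rw [G1k_laplaceAk_apply, map_add, map_add] at h2
  exact h2

end Literature.MathematicalPhysics.QuantumFieldTheory.Balaban1983to89.B9Eq3130HessianSlotDifferenceTower

end
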